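import Literature.AlgebraicGeometry.Resolution.ArithmeticalThreefoldsLocalIndependent
import Mathlib.RingTheory.MvPowerSeries.Inverse
import Mathlib.RingTheory.MvPowerSeries.Order

/-!
# `WeightedInvariant.LocalWeightedDrop`: LINE `directrix-cut` — COSSART–PILTANT'S ASSUMPTION (E) FROM A MONOMIAL DISCRIMINANT (the algebraic entry to the leaf F-99c)

W4.3 / crux `stmt-ResolutionOfSingularities-8899`; strategist helper (res-L1-w43-strat-1, gen 11) for the C sub-skeleton `cpscope_split_v1.lean` (2bc1215af5641faf):
its PREPARED positions carry the leaf's own predicate `CossartPiltant2019.ConditionE p k⟦x₁..x_m⟧ h x (fun j => X (ι j))` (Cossart–Piltant 2019, Def. 2.32,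
typed in `Literature.AlgebraicGeometry.Resolution.ArithmeticalThreefoldsLocalIndependent`).  This file proves, over Mathlib and that definition only:

* `two_le_order_of_mem_sq` — an element of `𝔪²`, `𝔪` the maximal ideal of `k⟦x₁..x_m⟧`, has order `≥ 2`;
* `exists_linearIndependent_toCotangent_X` — distinct variables `X (ι j)` (`ι` injective) lie in `𝔪` and have linearly independent classes in the cotangent space
  `𝔪/𝔪²` over the residue field (the «extends to a regular system of parameters» clause of Def. 2.19);
* `charP_residueField` — the residue field of `k⟦x₁..x_m⟧` has the characteristic of `k`;
* `conditionE_of_discr_eq_mul_prod` — **if the discriminant of `h ∈ k⟦x₁..x_m⟧[X]` is a unit times a monomial in the boundary letters `X (ι j)`, then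
  `ConditionE p k⟦x₁..x_m⟧ h x (fun j => X (ι j))` holds** (clause (ii): `D ≠ 0`, every prime containing `D` contains a boundary letter, and `X (ι j) ∣ (p : k⟦x⟧) = 0`
  in equal characteristic), for every `x` in any field over `k⟦x₁..x_m⟧`;
* `prepared_conditionE_of_discr_eq_mul_prod` — the same in the exact `∀ L x, aeval x h = 0 → ConditionE …` shape of the PREPARED clause of `cpscope_split_v1`.

So the PREP stub's prover may aim at the statement IN OUR LANGUAGE «`Disc_X(h) = v · ∏ X_{ι j}^{n_j}`, `v(0) ≠ 0`» (Cossart–Piltant, p.301 L1–2: «Therefore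
assumption (E) is satisfied» once `D` is a monomial in a r.s.p.).  [OURS · candidates not facts · nothing of any manuscript beyond the cited definition;
AI-produced, weaker than expert review.]  Def-free.
-/

set_option linter.dupNamespace false

noncomputable section

namespace Summit.ResolutionOfSingularities.ResolutionOfSingularities.Theorems

namespace TameFourTupleDrop

open MvPowerSeries Literature.AlgebraicGeometry.Resolution IsLocalRing

variable {k : Type} [Field k] {m : ℕ}

/-! ## The maximal ideal of `k⟦x₁..x_m⟧` and orders -/

/-- Membership in the maximal ideal is vanishing of the constant coefficient. -/
theorem mem_maximalIdeal_iff_constantCoeff {f : MvPowerSeries (Fin m) k} :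
    f ∈ maximalIdeal (MvPowerSeries (Fin m) k) ↔ constantCoeff f = 0 := by
  rw [IsLocalRing.mem_maximalIdeal, mem_nonunits_iff, MvPowerSeries.isUnit_iff_constantCoeff, isUnit_iff_ne_zero, not_not]

/-- An element of `𝔪²` has order at least `2`. -/
theorem two_le_order_of_mem_sq {f : MvPowerSeries (Fin m) k} (hf : f ∈ (maximalIdeal (MvPowerSeries (Fin m) k)) ^ 2) :
    (2 : ℕ∞) ≤ f.order := by
  rw [pow_two] at hf
  refine Submodule.mul_induction_on hf ?_ ?_
  · intro a ha b hb
    have ha1 : (1 : ℕ∞) ≤ a.order := one_le_order_iff_constCoeff_eq_zero.mpr (mem_maximalIdeal_iff_constantCoeff.mp ha)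
    have hb1 : (1 : ℕ∞) ≤ b.order := one_le_order_iff_constCoeff_eq_zero.mpr (mem_maximalIdeal_iff_constantCoeff.mp hb)
    calc (2 : ℕ∞) = 1 + 1 := by norm_num
      _ ≤ a.order + b.order := add_le_add ha1 hb1
      _ ≤ (a * b).order := le_order_mul
  · intro a b ha hb
    exact (le_min ha hb).trans min_order_le_add

/-- Hence its coefficients of degree `< 2` vanish. -/
theorem coeff_eq_zero_of_mem_sq {f : MvPowerSeries (Fin m) k} (hf : f ∈ (maximalIdeal (MvPowerSeries (Fin m) k)) ^ 2)
    (d : Fin m →₀ ℕ) (hd : d.degree < 2) : coeff d f = 0 := by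
  apply MvPowerSeries.coeff_of_lt_order
  exact lt_of_lt_of_le (by exact_mod_cast hd) (two_le_order_of_mem_sq hf)

/-- The coefficient of `x_t` in `c · x_s`. -/
theorem coeff_single_one_mul_X (c : MvPowerSeries (Fin m) k) (s t : Fin m) :
    coeff (Finsupp.single t 1) (c * X s) = if s = t then constantCoeff c else 0 := by
  rw [X_def, coeff_mul_monomial, mul_one]
  by_cases hst : s = t
  · subst hst
    simp
  · have : ¬ Finsupp.single s 1 ≤ Finsupp.single t 1 := by
      rw [Finsupp.single_le_iff, Finsupp.single_apply, if_neg (Ne.symm hst)]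
      omega
    rw [if_neg this, if_neg hst]

/-! ## Distinct variables are part of a regular system of parameters -/

/-- The variables lie in the maximal ideal. -/
theorem X_mem_maximalIdeal (s : Fin m) : (X s : MvPowerSeries (Fin m) k) ∈ maximalIdeal (MvPowerSeries (Fin m) k) :=
  mem_maximalIdeal_iff_constantCoeff.mpr (constantCoeff_X s)

/-- Distinct variables have linearly independent images in the cotangent space `𝔪/𝔪²` over the residue field. -/
theorem exists_linearIndependent_toCotangent_X {e : ℕ} (ι : Fin e → Fin m) (hι : Function.Injective ι) :
    ∃ hu : ∀ j, (X (ι j) : MvPowerSeries (Fin m) k) ∈ maximalIdeal (MvPowerSeries (Fin m) k),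
      LinearIndependent (ResidueField (MvPowerSeries (Fin m) k))
        fun j => (maximalIdeal (MvPowerSeries (Fin m) k)).toCotangent ⟨X (ι j), hu j⟩ := by
  refine ⟨fun j => X_mem_maximalIdeal (ι j), ?_⟩
  rw [linearIndependent_iff']
  intro s g hg j hj
  -- lift the coefficients to the ring
  choose c hc using fun i => IsLocalRing.residue_surjective (R := MvPowerSeries (Fin m) k) (g i)
  have hsum : (maximalIdeal (MvPowerSeries (Fin m) k)).toCotangent
      (∑ i ∈ s, c i • (⟨X (ι i), X_mem_maximalIdeal (ι i)⟩ : maximalIdeal (MvPowerSeries (Fin m) k))) = 0 := by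
    rw [map_sum]
    rw [← hg]
    refine Finset.sum_congr rfl fun i _ => ?_
    rw [map_smul, ← hc i, ← IsLocalRing.ResidueField.algebraMap_eq, algebraMap_smul]
  rw [Ideal.toCotangent_eq_zero] at hsum
  have hmem : (∑ i ∈ s, c i * X (ι i) : MvPowerSeries (Fin m) k) ∈ (maximalIdeal (MvPowerSeries (Fin m) k)) ^ 2 := by
    have hcoe : ((∑ i ∈ s, c i • (⟨X (ι i), X_mem_maximalIdeal (ι i)⟩ : maximalIdeal (MvPowerSeries (Fin m) k)) :
        maximalIdeal (MvPowerSeries (Fin m) k)) : MvPowerSeries (Fin m) k) = ∑ i ∈ s, c i * X (ι i) := by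
      rw [AddSubmonoidClass.coe_finsetSum]
      refine Finset.sum_congr rfl fun i _ => ?_
      rw [SetLike.val_smul, smul_eq_mul]
    rw [← hcoe]
    exact hsum
  have hcoeff := coeff_eq_zero_of_mem_sq hmem (Finsupp.single (ι j) 1) (by rw [Finsupp.degree_single]; norm_num)
  rw [map_sum] at hcoeff
  simp_rw [coeff_single_one_mul_X] at hcoeff
  rw [Finset.sum_eq_single j] at hcoeff
  · rw [if_pos rfl] at hcoeff
    rw [← hc j, IsLocalRing.residue_eq_zero_iff, mem_maximalIdeal_iff_constantCoeff]
    exact hcoeff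
  · intro i _ hij
    rw [if_neg (fun h => hij (hι h))]
  · intro hj'
    exact absurd hj hj'

/-- The residue field of `k⟦x₁..x_m⟧` has the characteristic of `k`. -/
theorem charP_residueField (p : ℕ) [CharP k p] : CharP (ResidueField (MvPowerSeries (Fin m) k)) p :=
  charP_of_injective_algebraMap (algebraMap k (ResidueField (MvPowerSeries (Fin m) k))).injective p

/-- In characteristic `p`, `(p : k⟦x⟧) = 0`. -/
theorem natCast_eq_zero_of_charP (p : ℕ) [CharP k p] : (p : MvPowerSeries (Fin m) k) = 0 := by
  rw [← map_natCast (algebraMap k (MvPowerSeries (Fin m) k)) p, CharP.cast_eq_zero k p, map_zero]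

/-- A variable is non-zero. -/
theorem X_ne_zero' (s : Fin m) : (X s : MvPowerSeries (Fin m) k) ≠ 0 := by
  intro h
  have := coeff_index_single_self_X (R := k) s
  rw [h, map_zero] at this
  exact zero_ne_one this

/-! ## Assumption (E) from a monomial discriminant -/

/-- **Cossart–Piltant's assumption (E), clause (ii), from a monomial discriminant.**  If `Disc_X(h) = v · ∏_j X_{ι j}^{n_j}` with `v(0) ≠ 0` and `ι`
injective, then `(k⟦x₁..x_m⟧, h, E = div(∏ X_{ι j}))` satisfies `ConditionE p` (for any `x` in any field over `k⟦x₁..x_m⟧`, `char k = p`). -/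
theorem conditionE_of_discr_eq_mul_prod (p : ℕ) [CharP k p] {L : Type} [Field L] [Algebra (MvPowerSeries (Fin m) k) L]
    (h : Polynomial (MvPowerSeries (Fin m) k)) (x : L) {e : ℕ} {ι : Fin e → Fin m} (hι : Function.Injective ι)
    {v : MvPowerSeries (Fin m) k} (hv : constantCoeff v ≠ 0) (n : Fin e → ℕ) (hD : h.discr = v * ∏ j, X (ι j) ^ n j) :
    CossartPiltant2019.ConditionE p (MvPowerSeries (Fin m) k) h x (fun j => X (ι j)) := by
  refine ⟨charP_residueField p, exists_linearIndependent_toCotangent_X ι hι, Or.inr ⟨?_, ?_, ?_⟩⟩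
  · -- `D ≠ 0`
    rw [hD]
    refine mul_ne_zero (fun h0 => hv (by rw [h0, map_zero])) ?_
    rw [Finset.prod_ne_zero_iff]
    exact fun j _ => pow_ne_zero _ (X_ne_zero' (ι j))
  · -- every prime containing `D` contains a boundary letter
    intro 𝔭 _ _ hDmem
    rw [hD] at hDmem
    rcases (Ideal.IsPrime.mem_or_mem ‹𝔭.IsPrime› hDmem) with hvmem | hprod
    · exfalso
      have hvu : IsUnit v := MvPowerSeries.isUnit_iff_constantCoeff.mpr (isUnit_iff_ne_zero.mpr hv)
      exact Ideal.IsPrime.ne_top ‹𝔭.IsPrime› (Ideal.eq_top_of_isUnit_mem 𝔭 hvmem hvu)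
    · obtain ⟨j, _, hj⟩ := Ideal.IsPrime.prod_mem_iff.mp hprod
      exact ⟨j, Ideal.IsPrime.mem_of_pow_mem ‹𝔭.IsPrime› (n j) hj⟩
  · -- `E ⊆ div(p)`: `(p : k⟦x⟧) = 0`
    intro j
    rw [natCast_eq_zero_of_charP p]
    exact dvd_zero _

/-- The PREPARED clause of `cpscope_split_v1` from a monomial discriminant. -/
theorem prepared_conditionE_of_discr_eq_mul_prod (p : ℕ) [CharP k p]
    (h : Polynomial (MvPowerSeries (Fin m) k)) {e : ℕ} {ι : Fin e → Fin m} (hι : Function.Injective ι)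
    {v : MvPowerSeries (Fin m) k} (hv : constantCoeff v ≠ 0) (n : Fin e → ℕ) (hD : h.discr = v * ∏ j, X (ι j) ^ n j) :
    ∀ (L : Type) [Field L] [Algebra (MvPowerSeries (Fin m) k) L] (x : L),
      Polynomial.aeval x h = 0 → CossartPiltant2019.ConditionE p (MvPowerSeries (Fin m) k) h x (fun j => X (ι j)) :=
  fun _ _ _ x _ => conditionE_of_discr_eq_mul_prod p h x hι hv n hD

end TameFourTupleDrop

end Summit.ResolutionOfSingularities.ResolutionOfSingularities.Theorems
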